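import Summits.BirchSwinnertonDyer.BirchSwinnertonDyer.Theorems.PlecticLegsTwistSupplyStubPrimeRankCase
import HarnessLib

/-!
# `PlecticLegs.TwistSupply` (crux stmt-BirchSwinnertonDyer-18260), line `Sketch` = kurihara-fourier-support:
# the prime-rank case from a KURIHARA CERTIFICATE — unconditional (stub `stub_primeRankKurihara`)

The prime-rank chain of the line with its printed input replaced by its OUTPUT: if the analytic rank
of an elliptic `W/ℚ` is a prime `ℓ`, and `W` carries a *Kurihara certificate at `ℓ`* — a weight-2
cusp form `f` on `Γ₀(N)` with `aₙ(f) = aₙ(W)` (`IsNewformOf`), a square-free level `n` prime to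
`N` with `ℓ`-integral plus symbols `[a/n]⁺_f`, and discrete logarithms `ψ` with non-zero mod-`ℓ`
Kurihara number `δ_n = ∑_{a ∈ (ℤ/n)ˣ} [a/n]⁺ ∏ ψ_q(a)` — then the conclusion of the crux holds for
`W`: a totally real cyclic field of degree `ℓ` inside `ℚ(ζ_d)` all of whose non-trivial characters
are silent. NO named fact is assumed: modularity enters only as the datum `f`, and Kurihara's
conjecture only as the datum `(n, ψ)`. The conditional theorem `stub_primeRankCase` (Kim's class,
modulo modularity + Kim 2022 + period transfer) is `stub_kuriharaSupply` followed by this one; other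
certificate suppliers (Sakamoto 2022 at `ℓ = 3`; an exact modular-symbol computation for a given
curve, e.g. `5077a1` at `ℓ = 3`, `n = 7·13·163`; Kriz–Nordentoft 2023 §5.3) plug in here unchanged.
Chain: `stub_baseVanishing` → `stub_heckeDescent` (`d = 1`) → `primeRankCase_firstLemma` →
`stub_heckeDescent` (conductor) → `stub_birch` + `stub_conjugacy` → `stub_cycloGlue` (all landed).
-/

noncomputable section

-- D-0017: single-problem summit, so `Summit.BirchSwinnertonDyer.BirchSwinnertonDyer.…` repeats a
-- namespace BY DESIGN.
set_option linter.dupNamespace false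

open scoped MatrixGroups ModularForm Classical

open CongruenceSubgroup

namespace Summit.BirchSwinnertonDyer.BirchSwinnertonDyer.Theorems

open WeierstrassCurve Literature.NumberTheory.EllipticCurves
  Literature.NumberTheory.EllipticCurves.ModularForms

/-- **`TwistSupply` in the prime-rank case from a Kurihara certificate, unconditionally** (stub
`stub_primeRankKurihara` of line `Sketch`): for an elliptic `W/ℚ` whose analytic rank is a prime
`ℓ`, a cusp form `f ∈ S₂(Γ₀(N))` with `aₙ(f) = aₙ(W)`, a square-free `n` prime to `N` with
`ℓ`-integral symbols `[a/n]⁺_f` (`a ∈ (ℤ/n)ˣ`) and a non-zero mod-`ℓ` Kurihara number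
`kuriharaNumber f ℓ n ψ ≠ 0` give `m` (`= ` the conductor `d` of the forced order-`ℓ` character)
and `H ≤ Gal(ℚ(ζ_m)/ℚ)` (`= ker χ'`) with `ℚ(ζ_m)^H` totally real of degree `r_an(W)` and every
non-trivial character trivial on `H` silent. [folklore] -/
theorem stub_primeRankKurihara :
    ∀ (W : WeierstrassCurve ℚ) [W.IsElliptic] (ℓ : ℕ) [Fact ℓ.Prime], W.analyticRank = ℓ →
      ∀ (N : ℕ) [NeZero N] (f : CuspForm (Gamma0 N) 2), IsNewformOf W f →
      ∀ (n : ℕ) [NeZero n], Squarefree n → n.Coprime N →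
      (∀ a : (ZMod n)ˣ, ¬ ℓ ∣ (ratPlusSymbol f (((a : ZMod n).val : ℚ) / n)).den) →
      ∀ ψ : (q : ℕ) → (ZMod q)ˣ →* Multiplicative (ZMod ℓ), kuriharaNumber f ℓ n ψ ≠ 0 →
      ∃ (m : ℕ) (_ : NeZero m),
        ∃ H : Subgroup (CyclotomicField m ℚ ≃ₐ[ℚ] CyclotomicField m ℚ),
          NumberField.IsTotallyReal ↥(IntermediateField.fixedField H) ∧
          Module.finrank ℚ ↥(IntermediateField.fixedField H) = W.analyticRank ∧
          ∀ χ : DirichletCharacter ℂ m,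
            (∀ σ ∈ H, ∀ a : ℕ, (∀ z : CyclotomicField m ℚ, z ^ m = 1 → σ z = z ^ a) →
              χ (a : ZMod m) = 1) → χ ≠ 1 →
            ∃ L : ℂ → ℂ, Differentiable ℂ L ∧
              (∀ s : ℂ, 2 < s.re → L s = LSeries (fun n ↦ χ n * ((W.LFunction n : ℤ) : ℂ)) s) ∧
              L 1 ≠ 0 := by
  intro W instW ℓ hℓ hr N hN f hf n hn hsq hcop hint ψ hδ
  have hℓp : ℓ.Prime := hℓ.out
  have hQ : coeffField f = ⊥ := hf.coeffField_eq_bot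
  -- base vanishing `[0]⁺ = 0` and `∑_{a ∈ (ℤ/n)ˣ} [a/n]⁺ = 0` (descent with `d = 1`, `χ' = 1`)
  have h00 : ratPlusSymbol f 0 = 0 :=
    stub_baseVanishing W N f hf (by rw [hr]; exact hℓp.one_lt.le)
  have h0 : ∑ a : (ZMod n)ˣ, ratPlusSymbol f (((a : ZMod n).val : ℚ) / n) = 0 := by
    by_contra hne
    have hne' : (∑ a : (ZMod n)ˣ, (DirichletCharacter.changeLevel (one_dvd n)
        (1 : DirichletCharacter ℂ 1)) (a : ZMod n) *
          ((ratPlusSymbol f (((a : ZMod n).val : ℚ) / n) : ℚ) : ℂ)) ≠ 0 := by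
      rw [DirichletCharacter.changeLevel_one]
      simp only [MulChar.one_apply_coe, one_mul]
      exact_mod_cast hne
    have h1 := stub_heckeDescent N f hf.1 hQ n 1 (one_dvd n) hsq hcop 1 hne'
    apply h1
    have huniv : ∀ b : ZMod 1, b = 0 := fun b ↦ Subsingleton.elim _ _
    rw [Fintype.sum_eq_single (0 : ZMod 1) (fun b hb ↦ absurd (huniv b) hb)]
    simp only [ZMod.val_zero, Nat.cast_zero, zero_div, h00, Rat.cast_zero, mul_zero]
  -- first lemma: a character of exponent `ℓ` with non-vanishing twisted sum at level `n`
  obtain ⟨χ, hχℓ, hχ1, hsum⟩ := primeRankCase_firstLemma f ℓ n ψ hint h0 hδ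
  -- descend to the conductor `d` and the primitive character `χ'`
  set d : ℕ := χ.conductor with hd_def
  haveI hd0 : NeZero d := ⟨χ.conductor_ne_zero⟩
  set χ' : DirichletCharacter ℂ d := χ.primitiveCharacter with hχ'_def
  have hdn : d ∣ n := χ.conductor_dvd_level
  have hfac : DirichletCharacter.changeLevel hdn χ' = χ := χ.changeLevel_primitiveCharacter
  have hprim : χ'.IsPrimitive := χ.primitiveCharacter_isPrimitive
  have hsum' : (∑ b : ZMod d, χ' b * ((ratPlusSymbol f ((b.val : ℚ) / d) : ℚ) : ℂ)) ≠ 0 := by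
    refine stub_heckeDescent N f hf.1 hQ n d hdn hsq hcop χ' ?_
    rw [hfac]
    exact hsum
  -- `χ'` has order `ℓ`
  have hχ'ℓ : χ' ^ ℓ = 1 := by
    apply DirichletCharacter.changeLevel_injective hdn
    rw [map_pow, hfac, hχℓ, map_one]
  have hχ'1 : χ' ≠ 1 := by
    intro h1
    apply hχ1
    rw [← hfac, h1, map_one]
  have hordχ' : orderOf χ' = ℓ := orderOf_eq_prime hχ'ℓ hχ'1
  -- Birch at `χ'` itself: evenness
  have heven : χ'.Even := (stub_birch W N f hf d χ' hprim hsum').1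
  -- all non-trivial powers of `χ'` are silent
  have hsil : ∀ j : ℕ, χ' ^ j ≠ 1 → ∃ L : ℂ → ℂ, Differentiable ℂ L ∧
      (∀ s : ℂ, 2 < s.re →
        L s = LSeries (fun k ↦ (χ' ^ j) k * ((W.LFunction k : ℤ) : ℂ)) s) ∧ L 1 ≠ 0 := by
    intro j hj
    have hjℓ : j.Coprime ℓ := by
      rw [Nat.coprime_comm, Nat.Prime.coprime_iff_not_dvd hℓp]
      intro hdvd
      apply hj
      obtain ⟨c, rfl⟩ := hdvd
      rw [pow_mul, hχ'ℓ, one_pow]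
    -- `k = j (ℓ - 1)` is prime to `ℓ` and `(χ'^k)⁻¹ = χ'^j`
    set k : ℕ := j * (ℓ - 1) with hk
    have hkℓ : k.Coprime (orderOf χ') := by
      rw [hordχ', hk]
      apply Nat.Coprime.mul_left hjℓ
      have h2 : 2 ≤ ℓ := hℓp.two_le
      rw [Nat.coprime_comm, Nat.Prime.coprime_iff_not_dvd hℓp]
      intro hdvd
      have := Nat.le_of_dvd (by omega) hdvd
      omega
    obtain ⟨hprimk, hsumk⟩ := stub_conjugacy N f d χ' k hprim hkℓ
    obtain ⟨-, L, hL, hLeq, hL1⟩ := stub_birch W N f hf d (χ' ^ k) hprimk (hsumk hsum')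
    have hinvk : (χ' ^ k)⁻¹ = χ' ^ j := by
      rw [inv_eq_iff_mul_eq_one, ← pow_add, hk]
      have : j * (ℓ - 1) + j = ℓ * j := by
        have h2 : 1 ≤ ℓ := hℓp.one_lt.le
        zify [h2]
        ring
      rw [this, pow_mul, hχ'ℓ, one_pow]
    refine ⟨L, hL, fun s hs ↦ ?_, hL1⟩
    rw [hLeq s hs, hinvk]
  -- glue
  obtain ⟨H, hreal, hdeg, hchar⟩ := stub_cycloGlue d χ' heven
  refine ⟨d, hd0, H, hreal, by rw [hdeg, hordχ', hr], ?_⟩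
  intro χ'' hχ'' hne
  obtain ⟨j, rfl⟩ := hchar χ'' hχ''
  exact hsil j hne

end Summit.BirchSwinnertonDyer.BirchSwinnertonDyer.Theorems

end
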